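import Summits.RiemannHypothesis.RiemannHypothesis.Theorems.GroundBartaPolarPerronFrobeniusEvenSectorNegativity
import HarnessLib

/-!
# CAND SEAT 8 (pub-rhpf-cand-8, gens 2–3) — the GROUND-LEVEL DECAY BIT is a thermometer
(harness candidate `cand8-005-ground-decay-L2-v1`; helper of stmt-RiemannHypothesis-19953)

mechanism/rigidity campaign; no RH claims.  Everything below is an RH-free, kernel-checked
consequence of tree theorems; no lower bound on any ground energy is assumed anywhere.

Setting (tree vocabulary, additive window `[-a, a]`, `λ = eᵃ`): `ε_ev(a) = weilEvenGroundEnergy a`,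
`ε_odd(a) = weilOddGroundEnergy a` (bottoms of Weil's truncated hermitian form on the even / odd
sector of the window).  The harness candidate `cand8-005` reads, on a nested pair of served windows
`a ≤ b` of the same object, the DECAY BIT `|ε_S(b)| < |ε_S(a)|` for both parities `S`.

* §1 `pos_of_le_of_abs_lt` — pure order lemma: `y ≤ x` and `|y| < |x|` force `0 < x`.
* §2 PER-WINDOW SOUNDNESS (continuum): by antitonicity of `ε_S` in the window
  (`weilEvenGroundEnergy_antitone`, `weilOddGroundEnergy_antitoneOn`; Bombieri 2000, Thm 5) the
  decay bit at a pair `a ≤ b` implies `0 < ε_S(a)`: the candidate is an implies-P-per-window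
  (R1) reader in L2 clothing — `weilEvenGroundEnergy_pos_of_decayBit`,
  `weilOddGroundEnergy_pos_of_decayBit`, and the contrapositive
  `abs_weilEvenGroundEnergy_mono_of_nonpos` (past a non-positive window the modulus cannot shrink).
* §3 (Z)-LABEL: the ∀a (even eventually-∀a) decay bit is RH-strength —
  `riemannHypothesis_of_eventually_evenDecayBit` (off RH, `ε_ev(a) ≤ -η < 0` for all large `a`,
  tree `PolarPerronFrobenius.weilEvenGroundEnergy_le_neg_of_not_riemannHypothesis`, contradicting
  §2).  The RH-free content of the harness verdict is therefore only the decay RATE (DATA: ≥ 7.085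
  decades per unit `a` on every served ζ pair), a STEP-hypothesis datum, not an invariant.
-/

set_option linter.dupNamespace false  -- the mandated namespace repeats `RiemannHypothesis`

open Set
open Literature.NumberTheory.LFunctions

namespace Summit.RiemannHypothesis.RiemannHypothesis.Theorems.PfPersistenceGroundDecayBit

open Summit.RiemannHypothesis.RiemannHypothesis.Theorems.PolarPerronFrobenius

/-! ## §1 Order lemma -/

/-- If `y ≤ x` and `|y| < |x|` then `0 < x`. [folklore] -/
theorem pos_of_le_of_abs_lt {x y : ℝ} (hle : y ≤ x) (hlt : |y| < |x|) : 0 < x := by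
  by_contra hx
  have hx : x ≤ 0 := not_lt.mp hx
  rw [abs_of_nonpos hx, abs_of_nonpos (hle.trans hx)] at hlt
  linarith

/-- If `y ≤ x ≤ 0` then `|x| ≤ |y|`. [folklore] -/
theorem abs_le_abs_of_le_of_nonpos {x y : ℝ} (hle : y ≤ x) (hx : x ≤ 0) : |x| ≤ |y| := by
  rw [abs_of_nonpos hx, abs_of_nonpos (hle.trans hx)]
  linarith

/-! ## §2 Per-window soundness of the decay bit (continuum) -/

/-- **Even decay bit ⇒ positivity.**  If `0 < a ≤ b` and `|ε_ev(b)| < |ε_ev(a)|` then `0 < ε_ev(a)`.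
[folklore; antitonicity = Bombieri2000Weil §4 Thm 5] -/
theorem weilEvenGroundEnergy_pos_of_decayBit {a b : ℝ} (ha : 0 < a) (hab : a ≤ b)
    (hlt : |weilEvenGroundEnergy b| < |weilEvenGroundEnergy a|) :
    0 < weilEvenGroundEnergy a :=
  pos_of_le_of_abs_lt (weilEvenGroundEnergy_antitone ha hab) hlt

/-- **Odd decay bit ⇒ positivity.**  If `0 < a ≤ b` and `|ε_odd(b)| < |ε_odd(a)|` then
`0 < ε_odd(a)`. [folklore] -/
theorem weilOddGroundEnergy_pos_of_decayBit {a b : ℝ} (ha : 0 < a) (hab : a ≤ b)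
    (hlt : |weilOddGroundEnergy b| < |weilOddGroundEnergy a|) :
    0 < weilOddGroundEnergy a :=
  pos_of_le_of_abs_lt (weilOddGroundEnergy_antitoneOn ha (ha.trans_le hab) hab) hlt

/-- **Contrapositive (window-soundness of `cand8-005` at the continuum level).**  Past a window where
`ε_ev ≤ 0` the modulus of `ε_ev` cannot shrink: `0 < a ≤ b`, `ε_ev(a) ≤ 0` ⇒ `|ε_ev(a)| ≤ |ε_ev(b)|`.
[folklore] -/
theorem abs_weilEvenGroundEnergy_mono_of_nonpos {a b : ℝ} (ha : 0 < a) (hab : a ≤ b)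
    (hna : weilEvenGroundEnergy a ≤ 0) :
    |weilEvenGroundEnergy a| ≤ |weilEvenGroundEnergy b| :=
  abs_le_abs_of_le_of_nonpos (weilEvenGroundEnergy_antitone ha hab) hna

/-- Same for the odd sector. [folklore] -/
theorem abs_weilOddGroundEnergy_mono_of_nonpos {a b : ℝ} (ha : 0 < a) (hab : a ≤ b)
    (hna : weilOddGroundEnergy a ≤ 0) :
    |weilOddGroundEnergy a| ≤ |weilOddGroundEnergy b| :=
  abs_le_abs_of_le_of_nonpos (weilOddGroundEnergy_antitoneOn ha (ha.trans_le hab) hab) hna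

/-! ## §3 The ∀a decay bit is RH-strength ((Z)-label of `cand8-005`) -/

/-- The continuum decay bit of the even sector at window `a`: some later window has a strictly
smaller bottom modulus (typed form of harness candidate `cand8-005`, even half). [folklore] -/
def EvenDecayBit (a : ℝ) : Prop :=
  ∃ b : ℝ, a ≤ b ∧ |weilEvenGroundEnergy b| < |weilEvenGroundEnergy a|

/-- The decay bit at a window forces even positivity there. [folklore] -/
theorem weilEvenGroundEnergy_pos_of_evenDecayBit {a : ℝ} (ha : 0 < a) (h : EvenDecayBit a) :
    0 < weilEvenGroundEnergy a := by
  obtain ⟨b, hab, hlt⟩ := h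
  exact weilEvenGroundEnergy_pos_of_decayBit ha hab hlt

/-- **(Z)-label.**  If the even decay bit holds at every window `a ≥ a₀` (`a > 0`), the Riemann
hypothesis holds: off RH the even bottom is `≤ -η < 0` at all large windows
(`weilEvenGroundEnergy_le_neg_of_not_riemannHypothesis`), contradicting §2. [folklore] -/
theorem riemannHypothesis_of_eventually_evenDecayBit {a₀ : ℝ}
    (h : ∀ a : ℝ, a₀ ≤ a → 0 < a → EvenDecayBit a) : _root_.RiemannHypothesis := by
  by_contra hRH
  obtain ⟨η, hη, A, hA⟩ := weilEvenGroundEnergy_le_neg_of_not_riemannHypothesis hRH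
  have key : ∀ a : ℝ, A ≤ a → a₀ ≤ a → 0 < a → False := fun a hAa ha₀ ha0 ↦ by
    have hpos := weilEvenGroundEnergy_pos_of_evenDecayBit ha0 (h a ha₀ ha0)
    have hneg := hA a hAa
    linarith
  exact key (max (max A a₀) 1) ((le_max_left _ _).trans (le_max_left _ _))
    ((le_max_right _ _).trans (le_max_left _ _)) (lt_of_lt_of_le one_pos (le_max_right _ _))

/-- **(Z)-label, ∀a form.**  The even decay bit at every window `a > 0` implies RH. [folklore] -/
theorem riemannHypothesis_of_evenDecayBit (h : ∀ a : ℝ, 0 < a → EvenDecayBit a) :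
    _root_.RiemannHypothesis :=
  riemannHypothesis_of_eventually_evenDecayBit (a₀ := 1) fun a _ ha ↦ h a ha

/-- What the ∀a decay bit gives RH-free: even positivity at every window (the converse —
RH ⇒ strict decay — is NOT claimed; the decay RATE is data). [folklore] -/
theorem forall_weilEvenGroundEnergy_pos_of_evenDecayBit (h : ∀ a : ℝ, 0 < a → EvenDecayBit a) :
    ∀ a : ℝ, 0 < a → 0 < weilEvenGroundEnergy a :=
  fun a ha ↦ weilEvenGroundEnergy_pos_of_evenDecayBit ha (h a ha)

end Summit.RiemannHypothesis.RiemannHypothesis.Theorems.PfPersistenceGroundDecayBit
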